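import Mathlib
import Summits.NavierStokesRegularity.NavierStokesRegularity.Theorems.TransitMassLedgerLedgerRigidityEnergy
import Summits.NavierStokesRegularity.NavierStokesRegularity.Theorems.TransitMassLedgerLedgerRigidityLedger
import HarnessLib

/-!
# `TransitMassLedger.LedgerRigidity` — time-integrated window estimates
# (helper file for item stmt-NavierStokesRegularity-24398; `--supports`)

The time-integrated estimates of the ledger argument for a solution `V` of the `λ = 1` limit lattice
of a table `α` in the unit ball, with action `∫‖V_n‖ ≤ M` per shell, under an outflow-coercive mass
certificate `(ℓ, θ, κ)` (`C_A = shiftConst α (0,0,1)`, `C_Q = shiftConst α (0,0,0)`):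

* Step 1 `window_integral`: for every window of `w` consecutive shells carrying energy `≤ E` and every
  time interval, `∫ Σ_(i<w) κ‖A V_(a+i) − A V_(a+i+1)‖² ≤ 2‖ℓ‖√(wE) + 2‖ℓ‖C_A M + 2‖ℓ‖(C_Q+C_A) M`
  (the fixed-time inequality of file `…Ledger` integrated: FTC for the windowed ledger, Cauchy–Schwarz,
  and `O(M)` bounds for the boundary outflow / `θ` terms since `|⟪ℓ,A x⟫|, |θ x| = O(‖x‖)` on the ball);
* Step 3 `coercive_window_pointwise`: `Σ_(i<w) (‖A V_(a+i)‖ − η)₊² ≤ r² Σ_(i<w+r) ‖A V_(a+i) − A V_(a+i+1)‖²`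
  when every block of `r` shells carries energy `≤ E` and `C_A E ≤ rη`;
* Step 4 `shell_floor`: `η(∫⟪V_(n+1), A V_n⟫ − √(2ηC_A) M) ≤ ∫(‖A V_n‖ − η)₊²` (slow seepage costs action);
* `false_of_linear_le_sqrt`: `c₀ w ≤ C₁√(w+r) + C₂` for all `w` is absurd when `c₀ > 0`.

HONEST FRAMING: elementary real analysis of a MODEL lattice ODE (Tao 2016 §4, `λ = 1` limit);
nothing here concerns the Navier–Stokes equations.  No item is closed by this file.
-/

noncomputable section

set_option linter.dupNamespace false

namespace Summit.NavierStokesRegularity.NavierStokesRegularity.Theorems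

namespace TransitMassLedgerWindows

open MeasureTheory Filter Topology Finset intervalIntegral
open scoped RealInnerProductSpace
open Literature.Analysis.FluidPDE Literature.Analysis.FluidPDE.TaoCascade
open TransitMassLedgerEnergy TransitMassLedgerLedger

variable {m : ℕ} {α : Fin m → Fin m → Fin m → ℤ × ℤ × ℤ → ℝ} {ℓ : Em m} {θ : Em m → ℝ} {κ : ℝ}
  {V : ℤ → ℝ → Em m}

/-! ## Step 1: the integrated windowed ledger inequality -/

/-- A finite window of consecutive shells carries at most the total energy. [folklore] -/
theorem window_energy_le (hs : ∀ s : ℝ, Summable fun n : ℤ => ‖V n s‖ ^ 2) (a : ℤ) (N : ℕ)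
    (s : ℝ) : ∑ i ∈ range N, ‖V (a + i) s‖ ^ 2 ≤ ∑' j : ℤ, ‖V j s‖ ^ 2 := by
  have hinj : Set.InjOn (fun i : ℕ => a + (i : ℤ)) (range N : Set ℕ) :=
    fun i _ j _ hij => by simpa using hij
  rw [← Finset.sum_image (f := fun j : ℤ => ‖V j s‖ ^ 2) hinj]
  exact sum_window_le_tsum hs _ s

/-- **Integrated windowed ledger inequality** (Step 1): for a solution of the unit ball with action
`≤ M` per shell and window energy `≤ E`,
`∫_(s₁)^(s₂) Σ_(i<w) κ‖A V_(a+i) − A V_(a+i+1)‖² ≤ 2‖ℓ‖√(wE) + 2‖ℓ‖C_A M + 2‖ℓ‖(C_Q + C_A) M`.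
[cite: Tao2016AveragedNS, §4 Lemma 4.1 (4.8); route TransitMassLedger (ledger mechanism); this file] -/
theorem window_integral
    (hcert : ∀ x y : Em m, ‖x‖ ≤ 1 → ‖y‖ ≤ 1 →
      κ * ‖tableA α x - tableA α y‖ ^ 2 ≤ ⟪ℓ, tableQ α x + tableA α x + tableB α y x⟫ + θ x - θ y)
    (hκ : 0 ≤ κ) (hθc : Continuous θ) (hθ0 : θ 0 = 0)
    (hl : ∀ (n : ℤ) (s : ℝ), HasDerivAt (V n)
      (tableQ α (V n s) + tableA α (V (n - 1) s) + tableB α (V (n + 1) s) (V n s)) s)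
    (hb : ∀ (n : ℤ) (s : ℝ), ‖V n s‖ ≤ 1) {M : ℝ}
    (hact : ∀ n : ℤ, Integrable (fun s => ‖V n s‖) ∧ ∫ s, ‖V n s‖ ≤ M)
    {E : ℝ} (a : ℤ) (w : ℕ) (hEw : ∀ s, ∑ i ∈ range w, ‖V (a + i) s‖ ^ 2 ≤ E)
    {s₁ s₂ : ℝ} (h12 : s₁ ≤ s₂) :
    ∫ s in s₁..s₂, ∑ i ∈ range w, κ * ‖tableA α (V (a + i) s) - tableA α (V (a + i + 1) s)‖ ^ 2 ≤
      2 * (‖ℓ‖ * Real.sqrt (w * E)) + 2 * (‖ℓ‖ * shiftConst α (0, 0, 1) * M)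
        + 2 * (‖ℓ‖ * (shiftConst α (0, 0, 0) + shiftConst α (0, 0, 1)) * M) := by
  have hV := continuous_shell hl
  have hA := continuous_tableA α
  have hQ := continuous_tableQ α
  have hCA := shiftConst_nonneg α (0, 0, 1)
  have hCQ := shiftConst_nonneg α (0, 0, 0)
  -- the four integrands
  set D : ℝ → ℝ := fun s =>
    ∑ i ∈ range w, κ * ‖tableA α (V (a + i) s) - tableA α (V (a + i + 1) s)‖ ^ 2 with hD_def
  set P : ℝ → ℝ := fun s => ∑ i ∈ range w, ⟪ℓ, V (a + i) s⟫ with hP_def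
  set P' : ℝ → ℝ := fun s => ∑ i ∈ range w, ⟪ℓ, tableQ α (V (a + i) s) + tableA α (V (a + i - 1) s)
      + tableB α (V (a + i + 1) s) (V (a + i) s)⟫ with hP'_def
  set g₁ : ℝ → ℝ := fun s => ⟪ℓ, tableA α (V (a + w - 1) s)⟫ with hg₁_def
  set g₂ : ℝ → ℝ := fun s => ⟪ℓ, tableA α (V (a - 1) s)⟫ with hg₂_def
  set θ₁ : ℝ → ℝ := fun s => θ (V a s) with hθ₁_def
  set θ₂ : ℝ → ℝ := fun s => θ (V (a + w) s) with hθ₂_def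
  have hptw : ∀ s, D s ≤ P' s + (g₁ s - g₂ s) + (θ₁ s - θ₂ s) := fun s => window_pointwise hcert hb a w s
  -- continuity
  have hDc : Continuous D := by
    simp only [hD_def]
    exact continuous_finsetSum _ fun i _ =>
      continuous_const.mul (((hA.comp (hV _)).sub (hA.comp (hV _))).norm.pow 2)
  have hP'c : Continuous P' := by
    simp only [hP'_def]
    exact continuous_finsetSum _ fun i _ => continuous_const.inner
      (((hQ.comp (hV _)).add (hA.comp (hV _))).add (continuous_tableB_comp α (hV _) (hV _)))
  have hg₁c : Continuous g₁ := continuous_const.inner (hA.comp (hV _))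
  have hg₂c : Continuous g₂ := continuous_const.inner (hA.comp (hV _))
  have hθ₁c : Continuous θ₁ := hθc.comp (hV _)
  have hθ₂c : Continuous θ₂ := hθc.comp (hV _)
  -- integrate the pointwise inequality
  have h1 : ∫ s in s₁..s₂, D s ≤ ∫ s in s₁..s₂, (P' s + (g₁ s - g₂ s) + (θ₁ s - θ₂ s)) :=
    intervalIntegral.integral_mono_on h12 (hDc.intervalIntegrable _ _)
      (((hP'c.add (hg₁c.sub hg₂c)).add (hθ₁c.sub hθ₂c)).intervalIntegrable _ _) fun s _ => hptw s
  have iP' : IntervalIntegrable P' volume s₁ s₂ := hP'c.intervalIntegrable _ _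
  have ig₁ : IntervalIntegrable g₁ volume s₁ s₂ := hg₁c.intervalIntegrable _ _
  have ig₂ : IntervalIntegrable g₂ volume s₁ s₂ := hg₂c.intervalIntegrable _ _
  have iθ₁ : IntervalIntegrable θ₁ volume s₁ s₂ := hθ₁c.intervalIntegrable _ _
  have iθ₂ : IntervalIntegrable θ₂ volume s₁ s₂ := hθ₂c.intervalIntegrable _ _
  have ig : IntervalIntegrable (fun s => g₁ s - g₂ s) volume s₁ s₂ := ig₁.sub ig₂
  have iθ : IntervalIntegrable (fun s => θ₁ s - θ₂ s) volume s₁ s₂ := iθ₁.sub iθ₂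
  have iPg : IntervalIntegrable (fun s => P' s + (g₁ s - g₂ s)) volume s₁ s₂ := iP'.add ig
  have h2 : ∫ s in s₁..s₂, (P' s + (g₁ s - g₂ s) + (θ₁ s - θ₂ s)) =
      (∫ s in s₁..s₂, P' s) + ((∫ s in s₁..s₂, g₁ s) - ∫ s in s₁..s₂, g₂ s)
        + ((∫ s in s₁..s₂, θ₁ s) - ∫ s in s₁..s₂, θ₂ s) := by
    rw [intervalIntegral.integral_add iPg iθ, intervalIntegral.integral_add iP' ig,
      intervalIntegral.integral_sub ig₁ ig₂, intervalIntegral.integral_sub iθ₁ iθ₂]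
  -- the ledger term: FTC and Cauchy–Schwarz
  have hPd : ∀ s, HasDerivAt P (P' s) s := by
    intro s
    simp only [hP_def, hP'_def]
    exact HasDerivAt.fun_sum fun i _ => hasDerivAt_ledger hl ℓ (a + i) s
  have h3 : ∫ s in s₁..s₂, P' s = P s₂ - P s₁ :=
    integral_eq_sub_of_hasDerivAt (fun s _ => hPd s) (hP'c.intervalIntegrable _ _)
  have h4 : ∀ s, |P s| ≤ ‖ℓ‖ * Real.sqrt (w * E) := fun s => abs_windowLedger_le ℓ a w s (hEw s)
  -- the boundary outflow terms
  have hg : ∀ k : ℤ, |∫ s in s₁..s₂, ⟪ℓ, tableA α (V k s)⟫| ≤ ‖ℓ‖ * shiftConst α (0, 0, 1) * M := by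
    intro k
    refine abs_intervalIntegral_le (continuous_const.inner (hA.comp (hV k))) (hV k).norm (hact k).1
      (mul_nonneg (norm_nonneg _) hCA) (hact k).2 (fun s => norm_nonneg _) (fun s => ?_) h12
    calc |⟪ℓ, tableA α (V k s)⟫| ≤ ‖ℓ‖ * ‖tableA α (V k s)‖ := abs_real_inner_le_norm _ _
      _ ≤ ‖ℓ‖ * (shiftConst α (0, 0, 1) * ‖V k s‖ ^ 2) :=
          mul_le_mul_of_nonneg_left (norm_tableA_le α _) (norm_nonneg _)
      _ ≤ ‖ℓ‖ * (shiftConst α (0, 0, 1) * ‖V k s‖) := by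
          have := norm_sq_le_one hb k s
          have h0 := norm_nonneg (V k s)
          have : ‖V k s‖ ^ 2 ≤ ‖V k s‖ := by nlinarith [hb k s]
          exact mul_le_mul_of_nonneg_left (mul_le_mul_of_nonneg_left this hCA) (norm_nonneg _)
      _ = ‖ℓ‖ * shiftConst α (0, 0, 1) * ‖V k s‖ := by ring
  -- the boundary θ terms
  have hθ : ∀ k : ℤ, |∫ s in s₁..s₂, θ (V k s)| ≤
      ‖ℓ‖ * (shiftConst α (0, 0, 0) + shiftConst α (0, 0, 1)) * M := by
    intro k
    refine abs_intervalIntegral_le (hθc.comp (hV k)) (hV k).norm (hact k).1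
      (mul_nonneg (norm_nonneg _) (add_nonneg hCQ hCA)) (hact k).2 (fun s => norm_nonneg _)
      (fun s => ?_) h12
    calc |θ (V k s)| ≤ ‖ℓ‖ * (shiftConst α (0, 0, 0) + shiftConst α (0, 0, 1)) * ‖V k s‖ ^ 2 :=
          abs_theta_le hcert hθ0 hκ (hb k s)
      _ ≤ ‖ℓ‖ * (shiftConst α (0, 0, 0) + shiftConst α (0, 0, 1)) * ‖V k s‖ := by
          have h0 := norm_nonneg (V k s)
          have : ‖V k s‖ ^ 2 ≤ ‖V k s‖ := by nlinarith [hb k s]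
          exact mul_le_mul_of_nonneg_left this (mul_nonneg (norm_nonneg _) (add_nonneg hCQ hCA))
  -- assemble
  have e1 := h4 s₁
  have e2 := h4 s₂
  have e3 := hg (a + w - 1)
  have e4 := hg (a - 1)
  have e5 := hθ a
  have e6 := hθ (a + w)
  rw [abs_le] at e1 e2 e3 e4 e5 e6
  simp only [hg₁_def, hg₂_def, hθ₁_def, hθ₂_def] at h2
  linarith [e1.1, e1.2, e2.1, e2.2, e3.1, e3.2, e4.1, e4.2, e5.1, e5.2, e6.1, e6.2]

/-! ## Steps 3–4: coercivity of a window and the per-shell floor -/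

/-- **Coercivity of a window at a fixed time** (Step 3 summed): if every block of `r ≥ 1` consecutive
shells carries energy `≤ E` and `C_A E ≤ r η`, then
`Σ_(i<w) (‖A V_(a+i)‖ − η)₊² ≤ r² Σ_(i<w+r) ‖A V_(a+i) − A V_(a+i+1)‖²`.
[cite: Tao2016AveragedNS, §4 (4.1); route TransitMassLedger (coercivity); this file] -/
theorem coercive_window_pointwise (a : ℤ) (w : ℕ) {r : ℕ} (hr : 0 < r) (s : ℝ) {E η : ℝ}
    (hEwin : ∀ n : ℤ, ∑ j ∈ range r, ‖V (n + 1 + j) s‖ ^ 2 ≤ E)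
    (hη : shiftConst α (0, 0, 1) * E ≤ r * η) :
    ∑ i ∈ range w, (max (‖tableA α (V (a + i) s)‖ - η) 0) ^ 2 ≤
      r * (r * ∑ i ∈ range (w + r), ‖tableA α (V (a + i) s) - tableA α (V (a + i + 1) s)‖ ^ 2) := by
  have h1 : ∀ i ∈ range w, (max (‖tableA α (V (a + i) s)‖ - η) 0) ^ 2 ≤
      r * ∑ j ∈ range r, ‖tableA α (V (a + ((i + j : ℕ) : ℤ)) s)
        - tableA α (V (a + ((i + j : ℕ) : ℤ) + 1) s)‖ ^ 2 := by
    intro i _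
    have h := posPart_outflow_sq_le (α := α) (V := V) (a + i) s hr (hEwin (a + i)) hη
    refine h.trans (le_of_eq ?_)
    congr 1
    refine Finset.sum_congr rfl fun j _ => ?_
    push_cast
    ring_nf
  calc ∑ i ∈ range w, (max (‖tableA α (V (a + i) s)‖ - η) 0) ^ 2
      ≤ ∑ i ∈ range w, r * ∑ j ∈ range r, ‖tableA α (V (a + ((i + j : ℕ) : ℤ)) s)
          - tableA α (V (a + ((i + j : ℕ) : ℤ) + 1) s)‖ ^ 2 := Finset.sum_le_sum h1
    _ = r * ∑ i ∈ range w, ∑ j ∈ range r, ‖tableA α (V (a + ((i + j : ℕ) : ℤ)) s)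
          - tableA α (V (a + ((i + j : ℕ) : ℤ) + 1) s)‖ ^ 2 := by rw [Finset.mul_sum]
    _ ≤ r * (r * ∑ i ∈ range (w + r), ‖tableA α (V (a + i) s) - tableA α (V (a + i + 1) s)‖ ^ 2) :=
        mul_le_mul_of_nonneg_left
          (sum_sum_shift_le (d := fun k : ℕ => ‖tableA α (V (a + k) s) - tableA α (V (a + k + 1) s)‖ ^ 2)
            (fun _ => sq_nonneg _) w r) (Nat.cast_nonneg _)

/-- **Per-shell floor** (Step 4): for `η ≥ 0` and a solution of the unit ball with action `≤ M`,
`η (∫_(s₁)^(s₂) ⟪V_(n+1), A V_n⟫ − √(2ηC_A) M) ≤ ∫_(s₁)^(s₂) (‖A V_n‖ − η)₊²`.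
[cite: Tao2016AveragedNS, §4 (4.1), Lemma 4.1 (4.9); this file] -/
theorem shell_floor
    (hl : ∀ (n : ℤ) (s : ℝ), HasDerivAt (V n)
      (tableQ α (V n s) + tableA α (V (n - 1) s) + tableB α (V (n + 1) s) (V n s)) s)
    (hb : ∀ (n : ℤ) (s : ℝ), ‖V n s‖ ≤ 1) {M : ℝ}
    (hact : ∀ n : ℤ, Integrable (fun s => ‖V n s‖) ∧ ∫ s, ‖V n s‖ ≤ M)
    (n : ℤ) {η : ℝ} (hη : 0 ≤ η) {s₁ s₂ : ℝ} (h12 : s₁ ≤ s₂) :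
    η * ((∫ s in s₁..s₂, ⟪V (n + 1) s, tableA α (V n s)⟫)
        - Real.sqrt (2 * η * shiftConst α (0, 0, 1)) * M) ≤
      ∫ s in s₁..s₂, (max (‖tableA α (V n s)‖ - η) 0) ^ 2 := by
  have hV := continuous_shell hl
  have hA := continuous_tableA α
  have hCA := shiftConst_nonneg α (0, 0, 1)
  set t₀ := Real.sqrt (2 * η * shiftConst α (0, 0, 1)) with ht₀
  have ht₀0 : 0 ≤ t₀ := Real.sqrt_nonneg _
  -- pointwise
  have hptw : ∀ s, η * ⟪V (n + 1) s, tableA α (V n s)⟫ - η * t₀ * ‖V n s‖ ≤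
      (max (‖tableA α (V n s)‖ - η) 0) ^ 2 := by
    intro s
    have hflux : ⟪V (n + 1) s, tableA α (V n s)⟫ ≤ ‖tableA α (V n s)‖ :=
      calc ⟪V (n + 1) s, tableA α (V n s)⟫ ≤ ‖V (n + 1) s‖ * ‖tableA α (V n s)‖ :=
            real_inner_le_norm _ _
        _ ≤ 1 * ‖tableA α (V n s)‖ := mul_le_mul_of_nonneg_right (hb _ _) (norm_nonneg _)
        _ = ‖tableA α (V n s)‖ := one_mul _
    have hkey := key_pointwise (f := ‖tableA α (V n s)‖) (g := ‖V n s‖) (C := shiftConst α (0, 0, 1))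
      (t := t₀ * ‖V n s‖) hη (norm_tableA_le α _) (mul_nonneg ht₀0 (norm_nonneg _)) (by
        rw [mul_pow, ht₀, Real.sq_sqrt (by positivity)]; ring)
    nlinarith
  -- integrate
  have hc1 : Continuous fun s => η * ⟪V (n + 1) s, tableA α (V n s)⟫ - η * t₀ * ‖V n s‖ :=
    (continuous_const.mul ((hV _).inner (hA.comp (hV _)))).sub (continuous_const.mul (hV _).norm)
  have hc2 : Continuous fun s => (max (‖tableA α (V n s)‖ - η) 0) ^ 2 :=
    (((hA.comp (hV _)).norm.sub continuous_const).max continuous_const).pow 2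
  have h1 := intervalIntegral.integral_mono_on h12 (hc1.intervalIntegrable (μ := volume) _ _)
    (hc2.intervalIntegrable (μ := volume) _ _) fun s _ => hptw s
  have i1 : IntervalIntegrable (fun s => η * ⟪V (n + 1) s, tableA α (V n s)⟫) volume s₁ s₂ :=
    (continuous_const.mul ((hV _).inner (hA.comp (hV _)))).intervalIntegrable _ _
  have i2 : IntervalIntegrable (fun s => η * t₀ * ‖V n s‖) volume s₁ s₂ :=
    (continuous_const.mul (hV _).norm).intervalIntegrable _ _
  have h2 : ∫ s in s₁..s₂, (η * ⟪V (n + 1) s, tableA α (V n s)⟫ - η * t₀ * ‖V n s‖) =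
      η * (∫ s in s₁..s₂, ⟪V (n + 1) s, tableA α (V n s)⟫) - η * t₀ * ∫ s in s₁..s₂, ‖V n s‖ := by
    rw [intervalIntegral.integral_sub i1 i2, intervalIntegral.integral_const_mul,
      intervalIntegral.integral_const_mul]
  have h3 : ∫ s in s₁..s₂, ‖V n s‖ ≤ M := by
    rw [intervalIntegral.integral_of_le h12]
    exact (setIntegral_le_integral (hact n).1 (Eventually.of_forall fun s => norm_nonneg _)).trans
      (hact n).2
  have h4 : η * t₀ * (∫ s in s₁..s₂, ‖V n s‖) ≤ η * t₀ * M :=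
    mul_le_mul_of_nonneg_left h3 (mul_nonneg hη ht₀0)
  rw [h2] at h1
  linarith

/-! ## An elementary growth lemma -/

/-- No linear function is dominated by a square root: `c₀ w ≤ C₁ √(w + r) + C₂` for all `w ∈ ℕ` with
`c₀ > 0`, `C₁, C₂ ≥ 0` is absurd. [folklore] -/
theorem false_of_linear_le_sqrt {c₀ C₁ C₂ : ℝ} (hc₀ : 0 < c₀) (hC₁ : 0 ≤ C₁) (hC₂ : 0 ≤ C₂) (r : ℕ)
    (h : ∀ w : ℕ, c₀ * w ≤ C₁ * Real.sqrt (w + r) + C₂) : False := by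
  obtain ⟨N, hN⟩ := exists_nat_gt ((C₁ + C₁ * r + C₂) / c₀ + 1)
  have hN1 : (1 : ℝ) ≤ N := by
    have : 0 ≤ (C₁ + C₁ * r + C₂) / c₀ := by positivity
    linarith
  have hNc : C₁ + C₁ * r + C₂ < c₀ * N := by
    have := (div_lt_iff₀ hc₀).1 (by linarith : (C₁ + C₁ * r + C₂) / c₀ < N)
    linarith
  have hw := h (N * N)
  have hsqrt : Real.sqrt ((N * N : ℕ) + r) ≤ N + r := by
    rw [Real.sqrt_le_iff]
    refine ⟨by positivity, ?_⟩
    push_cast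
    have hr0 : (0 : ℝ) ≤ r := Nat.cast_nonneg _
    have hrr : (r : ℝ) ≤ (r : ℝ) ^ 2 := by
      rcases Nat.eq_zero_or_pos r with h0 | h0
      · simp [h0]
      · have : (1 : ℝ) ≤ r := Nat.one_le_cast.2 h0
        nlinarith
    nlinarith
  push_cast at hw hsqrt
  have hr0 : (0 : ℝ) ≤ r := Nat.cast_nonneg _
  have h1 : c₀ * (N * N) ≤ C₁ * (N + r) + C₂ :=
    hw.trans (by nlinarith [mul_le_mul_of_nonneg_left hsqrt hC₁])
  have h2 : C₁ * (N + r) + C₂ ≤ N * (C₁ + C₁ * r + C₂) := by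
    have e1 : C₁ * r * 1 ≤ C₁ * r * N := mul_le_mul_of_nonneg_left hN1 (mul_nonneg hC₁ hr0)
    have e2 : C₂ * 1 ≤ C₂ * N := mul_le_mul_of_nonneg_left hN1 hC₂
    nlinarith
  have h3 : (N : ℝ) * (C₁ + C₁ * r + C₂) < N * (c₀ * N) := mul_lt_mul_of_pos_left hNc (by linarith)
  nlinarith

end TransitMassLedgerWindows

end Summit.NavierStokesRegularity.NavierStokesRegularity.Theorems

end
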